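import Summits.BirchSwinnertonDyer.BirchSwinnertonDyer.Theorems.TwistFamilyManinDescentIsogenyTableFamiliesReduction
import Summits.BirchSwinnertonDyer.BirchSwinnertonDyer.Theorems.TwistFamilyManinDescentConductorSupportBound
import Literature.NumberTheory.EllipticCurves.ManinConstantConductorLt500000
import HarnessLib

/-!
# Route `TwistFamilyManinDescent`, crux `IsogenyTableFamiliesManinOne` (stmt-BirchSwinnertonDyer-25137): the FAMILY
# ENGINE — a whole `j`-family from an integral base model whose discriminant is supported on `{2} ∪ S` with
# `2⁸·∏_{q∈S} q² < 5·10⁵` (`--supports`)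

THEOREMS ONLY, no route file imported. `classAbsManinConstantEqOne_of_j_eq_of_disc_support`: granted modularity,
Cremona's `|c| = 1` for `N ≤ 5·10⁵` (both hypotheses, as in the item) and the WHOLE-FAMILY DESCENT `hT` (the shape
of item 25136 `TwistFamilyDescent` after modularity; landed as `twistFamilyDescent_proof`), if `W₀/ℤ` is an integral model with `j ∉ {0, 1728}` whose discriminant
is divisible only by `2` and by primes of a finite set `S` of primes `≥ 5` with `2⁸ · ∏_{q ∈ S} q² < 500000`, then
EVERY elliptic `W/ℚ` with `j(W) = j(W₀)` satisfies the class Manin certificate. Assembly of the tree pieces: the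
`j`-family reduction `classAbsManinConstantEqOne_of_j_eq_of_certificates` (whole-family descent, item 25136) with
`A = ∏ S`, and for each inner twist `W₀ ⊗ d₀` (`d₀` square-free on `{2} ∪ S`) the crude conductor support bound
`conductorNorm_dvd_of_good_outside` (`f₂ ≤ 8`, `f_q ≤ 2`) putting it in Cremona's range. This covers the isogeny-table
families at `ℓ ∈ {11, 19, 37, 43}` (base conductors `11², 19², 5²7², 43²`); the `17`-, `67`-, `163`-families need the
exact dyadic exponent and are NOT covered by this engine. Nothing about BSD is proved; Manin's conjecture is not proved.
-/

-- D-0017: single-problem summit, so `Summit.BirchSwinnertonDyer.BirchSwinnertonDyer.…` repeats a namespace BY DESIGN.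
set_option linter.dupNamespace false
set_option autoImplicit false

noncomputable section

open scoped Classical

open WeierstrassCurve Literature.NumberTheory.EllipticCurves Literature.NumberTheory.EllipticCurves.ModularForms
  Literature.NumberTheory.EllipticCurves.Rank1Residual

namespace Summit.BirchSwinnertonDyer.BirchSwinnertonDyer.Theorems.TwistFamilyManinDescent

/-- **The family engine.** See the module docstring. [cite: CremonaAlgorithms1997, §3.8]
[cite: Stevens1989, Lemmas (5.2), (5.4)] [cite: SilvermanATAEC1994, IV.10.4] -/
theorem classAbsManinConstantEqOne_of_j_eq_of_disc_support (hnf : exists_isNewformOf)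
    (hCre : cremona_abs_maninConstant_eq_one_of_level_le_500000)
    (hT : ∀ (E₀ : WeierstrassCurve ℚ) [E₀.IsElliptic] (A : ℕ),
      (∀ (q : ℕ) [Fact q.Prime], q ≠ 2 → Rank1Residual.Addv E₀ q → q ∣ A) →
      ∀ d₀ d₁ : ℤ, d₀ ≠ 0 → d₁ ≠ 0 → IsCoprime d₁ (2 * A * d₀) →
      ClassAbsManinConstantEqOne (E₀.quadraticTwist ((d₀ : ℤ) : ℚ)) →
      ClassAbsManinConstantEqOne (E₀.quadraticTwist ((-d₀ : ℤ) : ℚ)) →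
      ClassAbsManinConstantEqOne (E₀.quadraticTwist ((d₀ * d₁ : ℤ) : ℚ)))
    (W₀ : WeierstrassCurve ℤ) [(W₀.baseChange ℚ).IsElliptic]
    (h0 : (W₀.baseChange ℚ).j ≠ 0) (h1728 : (W₀.baseChange ℚ).j ≠ 1728)
    (S : Finset ℕ) (hSp : ∀ q ∈ S, q.Prime) (hS5 : ∀ q ∈ S, 5 ≤ q)
    (hΔ : ∀ q : ℕ, q.Prime → (q : ℤ) ∣ W₀.Δ → q = 2 ∨ q ∈ S)
    (hB : 2 ^ 8 * ∏ q ∈ S, q ^ 2 < 500000)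
    (W : WeierstrassCurve ℚ) [W.IsElliptic] (hjW : W.j = (W₀.baseChange ℚ).j) :
    ClassAbsManinConstantEqOne W := by
  have hlt := cremona_abs_maninConstant_eq_one_of_level_lt_500000_of_le_500000 hCre
  set A : ℕ := ∏ q ∈ S, q with hAdef
  -- a prime dividing `2·A` is `2` or in `S`
  have hprime2A : ∀ q : ℕ, q.Prime → q ∣ 2 * A → q = 2 ∨ q ∈ S := by
    intro q hq hdvd
    rcases (Nat.Prime.dvd_mul hq).mp hdvd with h | h
    · exact Or.inl ((Nat.prime_dvd_prime_iff_eq hq Nat.prime_two).mp h)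
    · right
      obtain ⟨r, hr, hqr⟩ := (Prime.dvd_finsetProd_iff hq.prime _).mp h
      rwa [(Nat.prime_dvd_prime_iff_eq hq (hSp r hr)).mp hqr]
  refine classAbsManinConstantEqOne_of_j_eq_of_certificates (W₀.baseChange ℚ) h0 h1728 A (hT _ A ?_) ?_ W hjW
  · -- every odd additive prime of the base is in `S`, hence divides `A`
    intro q _ hq2 hadd
    have hq : q.Prime := Fact.out
    by_cases hqS : q ∈ S
    · exact Finset.dvd_prod_of_mem _ hqS
    · exfalso
      have hnd : ¬ (q : ℤ) ∣ W₀.Δ := fun h ↦ by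
        rcases hΔ q hq h with h2 | hS
        · exact hq2 h2
        · exact hqS hS
      exact hadd.1 (Literature.NumberTheory.EllipticCurves.BurungaleSkinner2023.hasGoodReductionAtPrime_baseChange_int_of_not_dvd
        W₀ hnd)
  · -- the inner twists are in Cremona's range
    intro d₀ hd₀ _ hsupp
    have hd₀q : ((d₀ : ℤ) : ℚ) ≠ 0 := by exact_mod_cast hd₀
    haveI := (W₀.baseChange ℚ).isElliptic_quadraticTwist hd₀q
    have hB0 : 2 ^ 8 * ∏ q ∈ S, q ^ 2 ≠ 0 := by
      refine mul_ne_zero (by norm_num) (Finset.prod_ne_zero_iff.mpr fun q hq ↦ ?_)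
      exact pow_ne_zero _ (hSp q hq).ne_zero
    have hdvd : ((W₀.baseChange ℚ).quadraticTwist ((d₀ : ℤ) : ℚ)).conductorNorm ℤ ∣ 2 ^ 8 * ∏ q ∈ S, q ^ 2 := by
      refine conductorNorm_dvd_of_good_outside _ S hS5 ?_ _ hB0 (dvd_mul_right _ _) fun q hq ↦
        dvd_mul_of_dvd_right (Finset.dvd_prod_of_mem _ hq) _
      intro q hq hq2 hqS
      haveI := Fact.mk hq
      have hnΔ : ¬ (q : ℤ) ∣ W₀.Δ := fun h ↦ by
        rcases hΔ q hq h with h2 | hS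
        · exact hq2 h2
        · exact hqS hS
      have hnd : ¬ (q : ℤ) ∣ d₀ := fun h ↦ by
        rcases hprime2A q hq (hsupp q hq h) with h2 | hS
        · exact hq2 h2
        · exact hqS hS
      exact hasGoodReductionAtPrime_quadraticTwist_baseChange_int_of_not_dvd W₀ hq2 hnΔ hnd
    exact classAbsManinConstantEqOne_of_conductorNorm_lt_500000 hlt hnf _
      (lt_of_le_of_lt (Nat.le_of_dvd (Nat.pos_of_ne_zero hB0) hdvd) hB)

end Summit.BirchSwinnertonDyer.BirchSwinnertonDyer.Theorems.TwistFamilyManinDescent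

end
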